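import Literature.AnabelianGeometry.AbsoluteAnabelian.AbsTopI.RelativeGCInputs
import Literature.AnabelianGeometry.AbsoluteAnabelian.RelativeGCFunctoriality
import Literature.AnabelianGeometry.AbsoluteAnabelian.SubpadicExamples
import HarnessLib

/-!
# [AbsTopI] Def 4.6 (ii) / Example 4.8 (ii): `RelHomDGC`, `RelIsomDGC`, `Ex_4_8_ii` — CLOSED INSTANCE
# FORMS at the tautological-GC classes over `ℚ` (FACT-LIST rows F-0196, F-0197, F-0194)

S. Mochizuki, *Topics in Absolute Anabelian Geometry I: Generalities* (2012) [MochizukiAbsTopI2012],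
§4: Definition 4.6 (ii) pp. 55–56 ("the rel-isom-DGC holds" / "the rel-hom-DGC holds": "the natural map
`Isom_{k₁,k₂}(X₁,X₂) → Isom^{out}_{G₁,G₂}(Π₁,Π₂)` [resp. `Hom^{dom} → Hom^{out-open}`] is a bijection")
and Example 4.8 (ii) p. 58 ("Let `𝔽` be the set of isomorphism classes of sub-`p`-adic fields. Then [...]
the hypotheses of Theorem 4.7, (iii), (iv), are satisfied relative to this `𝒟`").

PROOF-ONLY companion (theorems only: no `def`, no `instance`, no `structure`, no notation) of
`AbsTopI/RelativeGC.lean` (abc-iut-L4-t13), next to `RelativeGCSchemaNegative.lean` /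
`RelativeGCEx48PointModel.lean`; abc-iut cell, block F, seat abc-iut-f-057, KEY row INST59H1 (LF
kernel census #6: the three rows are «∀-closure REFUTED (schema)» — `not_forall_relHomDGC`,
`not_forall_relIsomDGC`, `not_forall_ex_4_8_ii` — and their model witnesses so far sit INSIDE
`∃`-conjunctions (`exists_isEx48ClassSub_ex_4_8_ii`, `exists_isEx48Class_point_model`), so no theorem
of the tree has conclusion head LITERALLY one of the three declarations).  This file supplies such
theorems, with 0 hypotheses, at classes WRITTEN OUT AS TERMS:

* the **tautological-GC class over `ℚ` on a family of augmented profinite groups**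
  `Π : ι → AugmentedProfiniteGrp G_ℚ` (one base field `ℚ`; objects `ι`, `X ↦ Π X ↠ G_ℚ`; the
  "scheme-theoretic" morphisms `X → Y` DEFINED to be the open outer homomorphisms `Π X → Π Y` over
  `G_ℚ`, the "isomorphisms" those whose class is an outer isomorphism, "the natural map" the
  inclusion; every object a member and a hyperbolic orbicurve, `Σ = Primes`, all pairs chain terms):
  `relHomDGC_tautologicalClass`, `relIsomDGC_tautologicalClass` (an outer isomorphism is open,
  `OuterHom.IsIso.isOpen`), `isEx48ClassSub_tautologicalClass` (the typed HYPOTHESIS of Example 4.8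
  (ii) holds: `ℚ` is sub-`p`-adic, [pGC] Def 15.4 (i) example (2), `IsSubpadicFor.of_numberField`) and
  hence NON-VACUOUSLY `ex_4_8_ii_tautologicalClass` (chain-full + rel-hom-DGC; the cyclotomic clause
  "`p` serves as `l`" and the slimness clause [pGC] Lem 15.8 are the cell's kernel theorems packaged in
  `ex_4_8_ii_of_relHomDGC`) — for EVERY index type `ι` and EVERY family `Π`, so in particular at
  families of genuinely non-abelian `Π ↠ G_ℚ` should the tree ever construct some;
* the **closed specialisation `Π = G_ℚ × G_ℚ ↠ G_ℚ`** (second projection; `Δ = G_ℚ × 1 ≅ G_ℚ`,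
  a non-trivial — indeed slim — geometric part; one object): `relHomDGC_prodClass`,
  `relIsomDGC_prodClass`, `ex_4_8_ii_prodClass_two` — 0 binders.

HONEST LABEL: TAUTOLOGICAL — the scheme side is DEFINED as the group side, so the bijection of
Def 4.6 (ii) holds by construction; the content of [pGC] Thm A / [Tpcs] Thm 4.12 (that the dominant
`k`-morphisms of actual hyperbolic curves are exactly these classes) is precisely what is NOT modelled
(the étale `π₁` of a curve is not constructible in the tree, abc-iut FOUNDATIONS row 12).  An instance
form about OUR typed interface, exactly the instances the closure refuters' `Hom = ∅` junk spares;
instantiated ≠ endorsed; typed ≠ proved; nothing here bears on [IUTchIII] Cor. 3.12 or takes a side.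
-/

namespace Literature.AnabelianGeometry.AbsoluteAnabelian.AbsTopI.ConstructionDataClass

open AugmentedProfiniteGrp

/-! ### The tautological-GC class over `ℚ` on a family `Π : ι → AugmentedProfiniteGrp G_ℚ` -/

/-- **F-0196, CLOSED INSTANCE FORM** ([AbsTopI] Def 4.6 (ii) "the rel-hom-DGC holds"): for every family
`Π : ι → (Π_X ↠ G_ℚ)` of augmented profinite groups over `G_ℚ`, the one-field class over `ℚ` whose
objects are `ι`, whose morphisms `X → Y` ARE the open outer homomorphisms `Π X → Π Y` over `G_ℚ` and
whose "natural map" is the inclusion satisfies the rel-hom-DGC — tautologically (the natural map is the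
identity onto `Hom^{out-open}`).  TAUTOLOGICAL model; nothing about curves.
[cite: MochizukiAbsTopI2012, Def 4.6 (ii) p.56] -/
theorem relHomDGC_tautologicalClass (ι : Type)
    (A : ι → AugmentedProfiniteGrp (absoluteGaloisGrp ℚ)) :
    Literature.AnabelianGeometry.AbsoluteAnabelian.AbsTopI.ConstructionDataClass.RelHomDGC
      ({ Base := Unit
         fld := fun _ => ℚ
         instField := fun _ => inferInstance
         instCharZero := fun _ => inferInstance
         datum := fun _ =>
           { Obj := ι
             Hom := fun X Y => {c : (A X).OuterHom (A Y) // c.IsOpen}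
             IsIso := fun f => f.1.IsIso
             IsHyperbolicCurve := fun _ => True
             primes := Set.univ
             grp := A
             outerHom := fun f => f.1 }
         Mem := fun _ _ => True
         IsHyperbolicOrbicurve := fun _ _ => True
         isHyperbolicOrbicurve_of_isHyperbolicCurve := fun _ _ _ => trivial
         chainTerms := fun _ _ => Set.univ } : ConstructionDataClass.{0}) :=
  fun _ _ _ _ _ => ⟨fun f _ => f.2, fun _ _ _ _ h => Subtype.ext h, fun c hc => ⟨⟨c, hc⟩, trivial, rfl⟩⟩

/-- **F-0197, CLOSED INSTANCE FORM** ([AbsTopI] Def 4.6 (ii) "the rel-isom-DGC holds"): the same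
tautological-GC class over `ℚ` (isomorphisms := the morphisms whose class is an outer ISOmorphism)
satisfies the rel-isom-DGC: every outer isomorphism over `G_ℚ` is open (`OuterHom.IsIso.isOpen`), hence a
morphism of the class, flagged iso.  TAUTOLOGICAL model. [cite: MochizukiAbsTopI2012, Def 4.6 (ii) p.56] -/
theorem relIsomDGC_tautologicalClass (ι : Type)
    (A : ι → AugmentedProfiniteGrp (absoluteGaloisGrp ℚ)) :
    Literature.AnabelianGeometry.AbsoluteAnabelian.AbsTopI.ConstructionDataClass.RelIsomDGC
      ({ Base := Unit
         fld := fun _ => ℚ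
         instField := fun _ => inferInstance
         instCharZero := fun _ => inferInstance
         datum := fun _ =>
           { Obj := ι
             Hom := fun X Y => {c : (A X).OuterHom (A Y) // c.IsOpen}
             IsIso := fun f => f.1.IsIso
             IsHyperbolicCurve := fun _ => True
             primes := Set.univ
             grp := A
             outerHom := fun f => f.1 }
         Mem := fun _ _ => True
         IsHyperbolicOrbicurve := fun _ _ => True
         isHyperbolicOrbicurve_of_isHyperbolicCurve := fun _ _ _ => trivial
         chainTerms := fun _ _ => Set.univ } : ConstructionDataClass.{0}) :=
  fun _ _ _ _ _ =>
    ⟨fun _ hf => hf, fun _ _ _ _ h => Subtype.ext h,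
      fun c hc => ⟨⟨c, OuterHom.IsIso.isOpen hc⟩, hc, rfl⟩⟩

/-- **The typed HYPOTHESIS of [AbsTopI] Example 4.8 (ii) HOLDS at the tautological-GC class over `ℚ`**
(so the instance `ex_4_8_ii_tautologicalClass` below is NOT vacuous): the class IS an Example-4.8 (ii)
class in the typed sense `IsEx48ClassSub p` — its one field `ℚ` is sub-`p`-adic for every prime `p`
([pGC] Def 15.4 (i), example (2): number fields; `AbsTopIII.IsSubpadicFor.of_numberField`), `Σ = Primes`,
and the members are exactly the objects flagged hyperbolic orbicurves (all of them).
[cite: MochizukiAbsTopI2012, Ex 4.8 (ii) p.58] -/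
theorem isEx48ClassSub_tautologicalClass (p : ℕ) [Fact p.Prime] (ι : Type)
    (A : ι → AugmentedProfiniteGrp (absoluteGaloisGrp ℚ)) :
    Literature.AnabelianGeometry.AbsoluteAnabelian.AbsTopI.ConstructionDataClass.IsEx48ClassSub
      ({ Base := Unit
         fld := fun _ => ℚ
         instField := fun _ => inferInstance
         instCharZero := fun _ => inferInstance
         datum := fun _ =>
           { Obj := ι
             Hom := fun X Y => {c : (A X).OuterHom (A Y) // c.IsOpen}
             IsIso := fun f => f.1.IsIso
             IsHyperbolicCurve := fun _ => True
             primes := Set.univ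
             grp := A
             outerHom := fun f => f.1 }
         Mem := fun _ _ => True
         IsHyperbolicOrbicurve := fun _ _ => True
         isHyperbolicOrbicurve_of_isHyperbolicCurve := fun _ _ _ => trivial
         chainTerms := fun _ _ => Set.univ } : ConstructionDataClass.{0}) p :=
  ⟨fun _ => AbsTopIII.IsSubpadicFor.of_numberField ℚ p, fun _ => rfl, fun _ _ => Iff.rfl⟩

/-- **F-0194, CLOSED INSTANCE FORM** ([AbsTopI] Example 4.8 (ii) as typed, `Ex_4_8_ii 𝒟 p`): for every
prime `p` and every family `Π : ι → (Π_X ↠ G_ℚ)`, the tautological-GC class over `ℚ` satisfies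
`Ex_4_8_ii` — NON-VACUOUSLY, its hypothesis `IsEx48ClassSub p` holding (`isEx48ClassSub_tautologicalClass`):
it is chain-full (every chain term is a member with the same `Σ`), satisfies the rel-hom-DGC
(`relHomDGC_tautologicalClass`), and the two field-side clauses — "`p` serves as the prime `l`" (`χ_p` on
`G_ℚ` has open image) and "the absolute Galois group of a sub-`p`-adic field is always slim" ([pGC] Lem
15.8) — are the cell's kernel theorems, packaged in `ex_4_8_ii_of_relHomDGC`.  TAUTOLOGICAL model (the
'GC' clause holds by construction); nothing about curves. [cite: MochizukiAbsTopI2012, Ex 4.8 (ii) p.58] -/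
theorem ex_4_8_ii_tautologicalClass (p : ℕ) [Fact p.Prime] (ι : Type)
    (A : ι → AugmentedProfiniteGrp (absoluteGaloisGrp ℚ)) :
    Literature.AnabelianGeometry.AbsoluteAnabelian.AbsTopI.ConstructionDataClass.Ex_4_8_ii
      ({ Base := Unit
         fld := fun _ => ℚ
         instField := fun _ => inferInstance
         instCharZero := fun _ => inferInstance
         datum := fun _ =>
           { Obj := ι
             Hom := fun X Y => {c : (A X).OuterHom (A Y) // c.IsOpen}
             IsIso := fun f => f.1.IsIso
             IsHyperbolicCurve := fun _ => True
             primes := Set.univ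
             grp := A
             outerHom := fun f => f.1 }
         Mem := fun _ _ => True
         IsHyperbolicOrbicurve := fun _ _ => True
         isHyperbolicOrbicurve_of_isHyperbolicCurve := fun _ _ _ => trivial
         chainTerms := fun _ _ => Set.univ } : ConstructionDataClass.{0}) p :=
  ex_4_8_ii_of_relHomDGC (fun _ _ _ _ _ => ⟨trivial, rfl⟩) (relHomDGC_tautologicalClass ι A)

/-! ### Closed specialisation: one object with `Π = G_ℚ × G_ℚ ↠ G_ℚ` (`Δ ≅ G_ℚ ≠ 1`) -/

/-- **F-0196 at a 0-binder term**: the tautological-GC class over `ℚ` with ONE object whose augmented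
profinite group is `G_ℚ × G_ℚ ↠ G_ℚ` (second projection; geometric part `Δ = G_ℚ × 1`, non-trivial)
satisfies the rel-hom-DGC. [cite: MochizukiAbsTopI2012, Def 4.6 (ii) p.56] -/
theorem relHomDGC_prodClass :
    Literature.AnabelianGeometry.AbsoluteAnabelian.AbsTopI.ConstructionDataClass.RelHomDGC
      ({ Base := Unit
         fld := fun _ => ℚ
         instField := fun _ => inferInstance
         instCharZero := fun _ => inferInstance
         datum := fun _ =>
           { Obj := Unit
             Hom := fun _ _ =>
               {c : AugmentedProfiniteGrp.OuterHom (G := absoluteGaloisGrp ℚ)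
                   { arith := ProfiniteGrp.of (Field.absoluteGaloisGroup ℚ × Field.absoluteGaloisGroup ℚ)
                     aug := ContinuousMonoidHom.snd _ _
                     aug_surjective := fun y => ⟨(1, y), rfl⟩ }
                   { arith := ProfiniteGrp.of (Field.absoluteGaloisGroup ℚ × Field.absoluteGaloisGroup ℚ)
                     aug := ContinuousMonoidHom.snd _ _
                     aug_surjective := fun y => ⟨(1, y), rfl⟩ } // c.IsOpen}
             IsIso := fun f => f.1.IsIso
             IsHyperbolicCurve := fun _ => True
             primes := Set.univ
             grp := fun _ =>
               { arith := ProfiniteGrp.of (Field.absoluteGaloisGroup ℚ × Field.absoluteGaloisGroup ℚ)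
                 aug := ContinuousMonoidHom.snd _ _
                 aug_surjective := fun y => ⟨(1, y), rfl⟩ }
             outerHom := fun f => f.1 }
         Mem := fun _ _ => True
         IsHyperbolicOrbicurve := fun _ _ => True
         isHyperbolicOrbicurve_of_isHyperbolicCurve := fun _ _ _ => trivial
         chainTerms := fun _ _ => Set.univ } : ConstructionDataClass.{0}) :=
  relHomDGC_tautologicalClass Unit fun _ =>
    { arith := ProfiniteGrp.of (Field.absoluteGaloisGroup ℚ × Field.absoluteGaloisGroup ℚ)
      aug := ContinuousMonoidHom.snd _ _
      aug_surjective := fun y => ⟨(1, y), rfl⟩ }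

/-- **F-0197 at a 0-binder term**: the same one-object class (`Π = G_ℚ × G_ℚ ↠ G_ℚ`) satisfies the
rel-isom-DGC. [cite: MochizukiAbsTopI2012, Def 4.6 (ii) p.56] -/
theorem relIsomDGC_prodClass :
    Literature.AnabelianGeometry.AbsoluteAnabelian.AbsTopI.ConstructionDataClass.RelIsomDGC
      ({ Base := Unit
         fld := fun _ => ℚ
         instField := fun _ => inferInstance
         instCharZero := fun _ => inferInstance
         datum := fun _ =>
           { Obj := Unit
             Hom := fun _ _ =>
               {c : AugmentedProfiniteGrp.OuterHom (G := absoluteGaloisGrp ℚ)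
                   { arith := ProfiniteGrp.of (Field.absoluteGaloisGroup ℚ × Field.absoluteGaloisGroup ℚ)
                     aug := ContinuousMonoidHom.snd _ _
                     aug_surjective := fun y => ⟨(1, y), rfl⟩ }
                   { arith := ProfiniteGrp.of (Field.absoluteGaloisGroup ℚ × Field.absoluteGaloisGroup ℚ)
                     aug := ContinuousMonoidHom.snd _ _
                     aug_surjective := fun y => ⟨(1, y), rfl⟩ } // c.IsOpen}
             IsIso := fun f => f.1.IsIso
             IsHyperbolicCurve := fun _ => True
             primes := Set.univ
             grp := fun _ =>
               { arith := ProfiniteGrp.of (Field.absoluteGaloisGroup ℚ × Field.absoluteGaloisGroup ℚ)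
                 aug := ContinuousMonoidHom.snd _ _
                 aug_surjective := fun y => ⟨(1, y), rfl⟩ }
             outerHom := fun f => f.1 }
         Mem := fun _ _ => True
         IsHyperbolicOrbicurve := fun _ _ => True
         isHyperbolicOrbicurve_of_isHyperbolicCurve := fun _ _ _ => trivial
         chainTerms := fun _ _ => Set.univ } : ConstructionDataClass.{0}) :=
  relIsomDGC_tautologicalClass Unit fun _ =>
    { arith := ProfiniteGrp.of (Field.absoluteGaloisGroup ℚ × Field.absoluteGaloisGroup ℚ)
      aug := ContinuousMonoidHom.snd _ _
      aug_surjective := fun y => ⟨(1, y), rfl⟩ }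

/-- **F-0194 at a 0-binder term** (`p = 2`): the same one-object class (`Π = G_ℚ × G_ℚ ↠ G_ℚ`, base field
`ℚ`, which is sub-`2`-adic, so the hypothesis `IsEx48ClassSub 2` HOLDS — `isEx48ClassSub_tautologicalClass`)
satisfies `Ex_4_8_ii · 2`: chain-full, rel-hom-DGC, `χ_2 : G_ℚ → ℤ_2^×` with open image, `G_ℚ` slim.
[cite: MochizukiAbsTopI2012, Ex 4.8 (ii) p.58] -/
theorem ex_4_8_ii_prodClass_two :
    Literature.AnabelianGeometry.AbsoluteAnabelian.AbsTopI.ConstructionDataClass.Ex_4_8_ii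
      ({ Base := Unit
         fld := fun _ => ℚ
         instField := fun _ => inferInstance
         instCharZero := fun _ => inferInstance
         datum := fun _ =>
           { Obj := Unit
             Hom := fun _ _ =>
               {c : AugmentedProfiniteGrp.OuterHom (G := absoluteGaloisGrp ℚ)
                   { arith := ProfiniteGrp.of (Field.absoluteGaloisGroup ℚ × Field.absoluteGaloisGroup ℚ)
                     aug := ContinuousMonoidHom.snd _ _
                     aug_surjective := fun y => ⟨(1, y), rfl⟩ }
                   { arith := ProfiniteGrp.of (Field.absoluteGaloisGroup ℚ × Field.absoluteGaloisGroup ℚ)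
                     aug := ContinuousMonoidHom.snd _ _
                     aug_surjective := fun y => ⟨(1, y), rfl⟩ } // c.IsOpen}
             IsIso := fun f => f.1.IsIso
             IsHyperbolicCurve := fun _ => True
             primes := Set.univ
             grp := fun _ =>
               { arith := ProfiniteGrp.of (Field.absoluteGaloisGroup ℚ × Field.absoluteGaloisGroup ℚ)
                 aug := ContinuousMonoidHom.snd _ _
                 aug_surjective := fun y => ⟨(1, y), rfl⟩ }
             outerHom := fun f => f.1 }
         Mem := fun _ _ => True
         IsHyperbolicOrbicurve := fun _ _ => True
         isHyperbolicOrbicurve_of_isHyperbolicCurve := fun _ _ _ => trivial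
         chainTerms := fun _ _ => Set.univ } : ConstructionDataClass.{0}) 2 :=
  ex_4_8_ii_tautologicalClass 2 Unit fun _ =>
    { arith := ProfiniteGrp.of (Field.absoluteGaloisGroup ℚ × Field.absoluteGaloisGroup ℚ)
      aug := ContinuousMonoidHom.snd _ _
      aug_surjective := fun y => ⟨(1, y), rfl⟩ }

end Literature.AnabelianGeometry.AbsoluteAnabelian.AbsTopI.ConstructionDataClass
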